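import Literature.Probability.Percolation.TrapFenceGen
import HarnessLib

/-!
# The fence of a term with a TALL exterior vertical crossing

Topic `Literature/Probability/Percolation`; family `crit-perc` / near-critical percolation on `𝕋`.
A brick of the near-critical arm-separation theorem for four arms in the ADJACENT colour
arrangement (P. Nolin, EJP 13 (2008), Thm. 11, `j = 4`, `σ = BBWW` [arXiv 0711.4948: Thm. 10]).

`trap_exists_fence_tall` — the fence lemma `trap_exists_fence_gen` with one change: the open
vertical crossing through the end point `m` of the fence connection is a crossing of the TALL box
`[z₀ + k, z₀ + 2k] × [z₁ + 1, z₁ + 2k]` (the right crossing `E` of the frame restricted to the rows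
above the tip row), not only of the corner box `[z₀ + k, z₀ + 2k] × [z₁ + k, z₁ + 2k]`. Its lower
half — from `m` (row `≥ z₁ + k`, where the top crossing meets it) down to the row `z₁ + 1` — is the
second exterior branch of a fenced exit used by the landing step for two arms of the same colour
(a single exterior site never cuts both the fence connection near the side and this branch).
Proof: verbatim the tree's, with the slab `[z₁ + 1, z₁ + 2k]` of `E` and its sub-slab
`[z₁ + k, z₁ + 2k]` met by the top crossing. Everything here is proved; no named facts.

## References

* P. Nolin, Near-critical percolation in two dimensions, *Electron. J. Probab.* 13 (2008), §4.4,
  proof of Lemma 15 (arXiv 0711.4948: Lemma 14) [Nolin2008].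
* H. Kesten, *Percolation theory for mathematicians* (1982), §2.2 [KestenPTM1982].
-/

noncomputable section

open Set

namespace Literature.Probability.Percolation

open LatticeModels

/-- **The fence with a tall vertical crossing** (see the module docstring; statement as
`trap_exists_fence_gen` but with `OpenVCrossThrough` over `[z₀+k, z₀+2k] × [z₁+1, z₁+2k]`). [cite: Nolin2008, §4.4 Lemma 15 (proof) (arXiv 0711.4948: Lemma 14)] [cite: KestenPTM1982, §2.2] -/
theorem trap_exists_fence_tall {M k : ℕ} {c : Finset (Site 2)} {z : Site 2}
    (hk : 1 ≤ k) (hkM : 2 * (k : ℤ) + 1 ≤ M) (hc : (trapDomain M).IsCrossing c z)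
    {ω ω' : SiteConfig (Site 2)}
    (hagree : ∀ v, v ∉ (trapDomain M).lower c z → (v ∈ ω' ↔ v ∈ ω)) (hframe : ω' ∈ triFrameAt z k)
    {S : Set (Site 2)} (hcS : (↑c : Set (Site 2)) ⊆ S) (hSn : ∀ v ∈ S, triNorm v ≤ 2 * M) :
    ∃ m : Site 2, OpenVCrossThrough (triStrip (z 0 + k) (z 1 + 1) k (2 * k - 1)) (z 1 + 1) (z 1 + 2 * k) ω m ∧
      ∃ q ∈ S, ∃ p : Site 2, triGraph.Adj q p ∧
        PathIn triGraph ((trapFrameZone M z k ∩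
          {v | (triNorm v ≤ 2 * M → v ∈ (trapDomain M).above c z) ∧ (2 * (M : ℤ) < triNorm v → z 1 < v 1)}) ∩ ω ∩ Sᶜ) p m := by
  have hk' : (1 : ℤ) ≤ k := by exact_mod_cast hk
  have hzO := tip_mem_trapO hc
  have hz' := trapO_coord hzO
  obtain ⟨F⟩ := nonempty_frameData hframe
  -- sites off `lower c z` (in particular sites outside `Λ_{2M}`) carry the same colour in `ω`, `ω'`
  have hlowD : ∀ v ∈ (trapDomain M).lower c z, v ∈ trapD M := fun v hv => JDomain.lower_subset_D hc.subset hv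
  have hext : ∀ v : Site 2, 2 * (M : ℤ) < triNorm v → (v ∈ ω' ↔ v ∈ ω) := by
    intro v hv
    refine hagree v fun h => ?_
    have := (mem_trapD_iff_triNorm.1 (hlowD v h)).2
    omega
  -- the corner box is outside `Λ_{2M}`
  have hEext : ∀ v : Site 2, z 0 + k ≤ v 0 → 2 * (M : ℤ) < triNorm v := by
    intro v hv
    rw [triNorm_eq_max]
    simp only [lt_max_iff]
    omega
  -- the TALL part of the right crossing: a vertical crossing `V` of `[z₀+k, z₀+2k] × [z₁+1, z₁+2k]`
  obtain ⟨e₁, e₂, he₁, he₂, hV⟩ := F.pathE.exists_slab_crossing 1 (L := z 1 + 1) (R := z 1 + 2 * k)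
    (by omega) (by rw [F.xE1]; omega) (by rw [F.yE1])
  obtain ⟨SV, hSV, pV, tV⟩ := hV.exists_support
  have hSVb : ∀ v ∈ SV, z 0 + k ≤ v 0 ∧ v 0 ≤ z 0 + 2 * k ∧ z 1 + 1 ≤ v 1 ∧ v 1 ≤ z 1 + 2 * k := by
    intro v hv
    have h1 := F.boundsE (hSV hv).1
    have h2 := (hSV hv).2
    simp only [Set.mem_setOf_eq] at h2
    omega
  have hk21 : ((2 * k - 1 : ℕ) : ℤ) = 2 * (k : ℤ) - 1 := by omega
  have hSVω : SV ⊆ triStrip (z 0 + k) (z 1 + 1) k (2 * k - 1) ∩ ω := by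
    intro v hv
    have hb := hSVb v hv
    refine ⟨?_, (hext v (hEext v hb.1)).1 ((F.SE_sub (hSV hv).1).2)⟩
    rw [mem_triStrip, hk21]; omega
  -- its upper part: a vertical crossing `V'` of the corner box, met by the top crossing at `m`
  obtain ⟨e₁', e₂', he₁', he₂', hV'⟩ := pV.exists_slab_crossing 1 (L := z 1 + k) (R := z 1 + 2 * k)
    (by omega) (by rw [he₁]; omega) (by rw [he₂])
  obtain ⟨m, hmN, hmV'⟩ := PathIn.tri_crossings_meet (L := z 0 - 2 * k) (R := z 0 + 2 * k)
    (B := z 1 + k) (T := z 1 + 2 * k) (fun v hv => by have := F.boundsN hv; omega)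
    (fun v hv => by have := hSVb v hv.1; have h2 := hv.2; simp only [Set.mem_setOf_eq] at h2; omega) F.pathN F.xN0 F.yN0 hV' he₁' he₂'
  have hmV : m ∈ SV := hmV'.1
  refine ⟨m, ⟨e₁, e₂, he₁, he₂, (tV m hmV).mono hSVω, ((tV m hmV).symm.trans pV).mono hSVω⟩, ?_⟩
  -- `c` (hence `S`) meets `Y`
  have hmY : m ∈ F.Y := Or.inl (Or.inl hmN)
  obtain ⟨f, hfc, hfI⟩ := hc.exists_start
  obtain ⟨y, hyc, hyK⟩ := F.exists_mem_K hk (s := z) (t := f) (by omega)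
    (Or.inl (start_apply_zero_le hc hkM hfI)) (hc.conn z hc.tip_mem f hfc)
  have hyc' : y ∈ c := Finset.mem_coe.1 hyc
  have hyY : y ∈ F.Y := by
    rcases hyK with hy | hy
    · exact hy
    · exfalso
      have h1 := (F.boundsE hy).1
      have h2 := (mem_trapD.1 (hc.subset hyc')).2.1
      omega
  -- follow `Y` from `m` to the first site adjacent to `S`
  have hmext : 2 * (M : ℤ) < triNorm m := hEext m (hSVb m hmV).1
  have hmS : m ∈ Sᶜ := fun h => by have := hSn m h; omega
  obtain ⟨p, q, hpS, hqS, hqY, hpq, hmp⟩ := (F.pathIn_Y hk hmY hyY).exit (R := Sᶜ) hmS (fun h => h (hcS hyc))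
  have hqS' : q ∈ S := not_not.1 hqS
  have hmp' : PathIn triGraph ((F.Y \ ↑c) ∩ Sᶜ) m p :=
    hmp.mono fun v hv => ⟨⟨hv.2, fun hvc => hv.1 (hcS hvc)⟩, hv.1⟩
  -- the invariant along this path
  set G : Set (Site 2) := {v | (triNorm v ≤ 2 * M → v ∈ (trapDomain M).above c z) ∧
      (2 * (M : ℤ) < triNorm v → z 1 < v 1)} with hG
  have hmG : m ∈ G := ⟨fun h => absurd hmext (not_lt.2 h), fun _ => by have := (hSVb m hmV).2.2.1; omega⟩
  have hpath : PathIn triGraph (((F.Y \ ↑c) ∩ Sᶜ) ∩ G) m p :=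
    hmp'.inter_of_invariant hmG fun x w hx hxG hw hxw => trap_invariant_step hk hkM hc F hx.1 hw.1 hxw hxG.1 hxG.2
  -- sites satisfying the invariant are open sites of the zone
  have hsub : ((F.Y \ ↑c) ∩ Sᶜ) ∩ G ⊆ (trapFrameZone M z k ∩ G) ∩ ω ∩ Sᶜ := by
    rintro v ⟨⟨⟨hvY, -⟩, hvS⟩, hvin, hvout⟩
    have hb := F.boundsK (F.Y_subset_K hvY)
    have hvω' : v ∈ ω' := F.K_subset (F.Y_subset_K hvY)
    refine ⟨⟨⟨?_, hvin, hvout⟩, ?_⟩, hvS⟩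
    · by_cases hvn : triNorm v ≤ 2 * M
      · have hvT : v ∈ trapD M := mem_trapD_of_triNorm_le (by omega) hvn
        exact ⟨Or.inl hvT, by omega, by omega, by omega, by omega⟩
      · rw [not_le] at hvn
        exact ⟨Or.inr ⟨hvn, hvout hvn⟩, by omega, by omega, by omega, by omega⟩
    · by_cases hvn : triNorm v ≤ 2 * M
      · have hvT : v ∈ trapD M := mem_trapD_of_triNorm_le (by omega) hvn
        -- `v` is above, hence off `lower c z`, hence unfrozen
        have hva := hvin hvn
        have hvl : v ∉ (trapDomain M).lower c z := fun h =>
          ((JDomain.mem_lower_iff_not_mem_above (show v ∈ (trapDomain M).D from hvT)).1 h) hva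
        exact (hagree v hvl).1 hvω'
      · rw [not_le] at hvn
        exact (hext v hvn).1 hvω'
  exact ⟨q, hqS', p, hpq.symm, (hpath.mono hsub).symm⟩

/-- **The fence with both vertical crossings through `m`**: as `trap_exists_fence_tall`, recording also the open vertical crossing of the corner box `[z₀+k, z₀+2k] × [z₁+k, z₁+2k]` through the same `m`. [cite: Nolin2008, §4.4 Lemma 15 (proof) (arXiv 0711.4948: Lemma 14)] [cite: KestenPTM1982, §2.2] -/
theorem trap_exists_fence_tall₂ {M k : ℕ} {c : Finset (Site 2)} {z : Site 2}
    (hk : 1 ≤ k) (hkM : 2 * (k : ℤ) + 1 ≤ M) (hc : (trapDomain M).IsCrossing c z)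
    {ω ω' : SiteConfig (Site 2)}
    (hagree : ∀ v, v ∉ (trapDomain M).lower c z → (v ∈ ω' ↔ v ∈ ω)) (hframe : ω' ∈ triFrameAt z k)
    {S : Set (Site 2)} (hcS : (↑c : Set (Site 2)) ⊆ S) (hSn : ∀ v ∈ S, triNorm v ≤ 2 * M) :
    ∃ m : Site 2, OpenVCrossThrough (triStrip (z 0 + k) (z 1 + k) k k) (z 1 + k) (z 1 + 2 * k) ω m ∧
      OpenVCrossThrough (triStrip (z 0 + k) (z 1 + 1) k (2 * k - 1)) (z 1 + 1) (z 1 + 2 * k) ω m ∧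
      ∃ q ∈ S, ∃ p : Site 2, triGraph.Adj q p ∧
        PathIn triGraph ((trapFrameZone M z k ∩
          {v | (triNorm v ≤ 2 * M → v ∈ (trapDomain M).above c z) ∧ (2 * (M : ℤ) < triNorm v → z 1 < v 1)}) ∩ ω ∩ Sᶜ) p m := by
  have hk' : (1 : ℤ) ≤ k := by exact_mod_cast hk
  have hzO := tip_mem_trapO hc
  have hz' := trapO_coord hzO
  obtain ⟨F⟩ := nonempty_frameData hframe
  -- sites off `lower c z` (in particular sites outside `Λ_{2M}`) carry the same colour in `ω`, `ω'`
  have hlowD : ∀ v ∈ (trapDomain M).lower c z, v ∈ trapD M := fun v hv => JDomain.lower_subset_D hc.subset hv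
  have hext : ∀ v : Site 2, 2 * (M : ℤ) < triNorm v → (v ∈ ω' ↔ v ∈ ω) := by
    intro v hv
    refine hagree v fun h => ?_
    have := (mem_trapD_iff_triNorm.1 (hlowD v h)).2
    omega
  -- the corner box is outside `Λ_{2M}`
  have hEext : ∀ v : Site 2, z 0 + k ≤ v 0 → 2 * (M : ℤ) < triNorm v := by
    intro v hv
    rw [triNorm_eq_max]
    simp only [lt_max_iff]
    omega
  -- the TALL part of the right crossing: a vertical crossing `V` of `[z₀+k, z₀+2k] × [z₁+1, z₁+2k]`
  obtain ⟨e₁, e₂, he₁, he₂, hV⟩ := F.pathE.exists_slab_crossing 1 (L := z 1 + 1) (R := z 1 + 2 * k)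
    (by omega) (by rw [F.xE1]; omega) (by rw [F.yE1])
  obtain ⟨SV, hSV, pV, tV⟩ := hV.exists_support
  have hSVb : ∀ v ∈ SV, z 0 + k ≤ v 0 ∧ v 0 ≤ z 0 + 2 * k ∧ z 1 + 1 ≤ v 1 ∧ v 1 ≤ z 1 + 2 * k := by
    intro v hv
    have h1 := F.boundsE (hSV hv).1
    have h2 := (hSV hv).2
    simp only [Set.mem_setOf_eq] at h2
    omega
  have hk21 : ((2 * k - 1 : ℕ) : ℤ) = 2 * (k : ℤ) - 1 := by omega
  have hSVω : SV ⊆ triStrip (z 0 + k) (z 1 + 1) k (2 * k - 1) ∩ ω := by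
    intro v hv
    have hb := hSVb v hv
    refine ⟨?_, (hext v (hEext v hb.1)).1 ((F.SE_sub (hSV hv).1).2)⟩
    rw [mem_triStrip, hk21]; omega
  -- its upper part: a vertical crossing `V'` of the corner box, met by the top crossing at `m`
  obtain ⟨e₁', e₂', he₁', he₂', hV'⟩ := pV.exists_slab_crossing 1 (L := z 1 + k) (R := z 1 + 2 * k)
    (by omega) (by rw [he₁]; omega) (by rw [he₂])
  obtain ⟨SV', hSV', pV', tV'⟩ := hV'.exists_support
  have hSV'b : ∀ v ∈ SV', z 0 + k ≤ v 0 ∧ v 0 ≤ z 0 + 2 * k ∧ z 1 + k ≤ v 1 ∧ v 1 ≤ z 1 + 2 * k := by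
    intro v hv
    have hb := hSVb v (hSV' hv).1
    have h2 := (hSV' hv).2
    simp only [Set.mem_setOf_eq] at h2
    omega
  obtain ⟨m, hmN, hmV''⟩ := PathIn.tri_crossings_meet (L := z 0 - 2 * k) (R := z 0 + 2 * k)
    (B := z 1 + k) (T := z 1 + 2 * k) (fun v hv => by have := F.boundsN hv; omega)
    (fun v hv => by have := hSV'b v hv; omega) F.pathN F.xN0 F.yN0 pV' he₁' he₂'
  have hmV : m ∈ SV := (hSV' hmV'').1
  have hSV'ω : SV' ⊆ triStrip (z 0 + k) (z 1 + k) k k ∩ ω := by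
    intro v hv
    have hb := hSV'b v hv
    refine ⟨?_, (hSVω (hSV' hv).1).2⟩
    rw [mem_triStrip]; omega
  refine ⟨m, ⟨e₁', e₂', he₁', he₂', (tV' m hmV'').mono hSV'ω, ((tV' m hmV'').symm.trans pV').mono hSV'ω⟩,
    ⟨e₁, e₂, he₁, he₂, (tV m hmV).mono hSVω, ((tV m hmV).symm.trans pV).mono hSVω⟩, ?_⟩
  -- `c` (hence `S`) meets `Y`
  have hmY : m ∈ F.Y := Or.inl (Or.inl hmN)
  obtain ⟨f, hfc, hfI⟩ := hc.exists_start
  obtain ⟨y, hyc, hyK⟩ := F.exists_mem_K hk (s := z) (t := f) (by omega)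
    (Or.inl (start_apply_zero_le hc hkM hfI)) (hc.conn z hc.tip_mem f hfc)
  have hyc' : y ∈ c := Finset.mem_coe.1 hyc
  have hyY : y ∈ F.Y := by
    rcases hyK with hy | hy
    · exact hy
    · exfalso
      have h1 := (F.boundsE hy).1
      have h2 := (mem_trapD.1 (hc.subset hyc')).2.1
      omega
  -- follow `Y` from `m` to the first site adjacent to `S`
  have hmext : 2 * (M : ℤ) < triNorm m := hEext m (hSVb m hmV).1
  have hmS : m ∈ Sᶜ := fun h => by have := hSn m h; omega
  obtain ⟨p, q, hpS, hqS, hqY, hpq, hmp⟩ := (F.pathIn_Y hk hmY hyY).exit (R := Sᶜ) hmS (fun h => h (hcS hyc))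
  have hqS' : q ∈ S := not_not.1 hqS
  have hmp' : PathIn triGraph ((F.Y \ ↑c) ∩ Sᶜ) m p :=
    hmp.mono fun v hv => ⟨⟨hv.2, fun hvc => hv.1 (hcS hvc)⟩, hv.1⟩
  -- the invariant along this path
  set G : Set (Site 2) := {v | (triNorm v ≤ 2 * M → v ∈ (trapDomain M).above c z) ∧
      (2 * (M : ℤ) < triNorm v → z 1 < v 1)} with hG
  have hmG : m ∈ G := ⟨fun h => absurd hmext (not_lt.2 h), fun _ => by have := (hSVb m hmV).2.2.1; omega⟩
  have hpath : PathIn triGraph (((F.Y \ ↑c) ∩ Sᶜ) ∩ G) m p :=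
    hmp'.inter_of_invariant hmG fun x w hx hxG hw hxw => trap_invariant_step hk hkM hc F hx.1 hw.1 hxw hxG.1 hxG.2
  -- sites satisfying the invariant are open sites of the zone
  have hsub : ((F.Y \ ↑c) ∩ Sᶜ) ∩ G ⊆ (trapFrameZone M z k ∩ G) ∩ ω ∩ Sᶜ := by
    rintro v ⟨⟨⟨hvY, -⟩, hvS⟩, hvin, hvout⟩
    have hb := F.boundsK (F.Y_subset_K hvY)
    have hvω' : v ∈ ω' := F.K_subset (F.Y_subset_K hvY)
    refine ⟨⟨⟨?_, hvin, hvout⟩, ?_⟩, hvS⟩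
    · by_cases hvn : triNorm v ≤ 2 * M
      · have hvT : v ∈ trapD M := mem_trapD_of_triNorm_le (by omega) hvn
        exact ⟨Or.inl hvT, by omega, by omega, by omega, by omega⟩
      · rw [not_le] at hvn
        exact ⟨Or.inr ⟨hvn, hvout hvn⟩, by omega, by omega, by omega, by omega⟩
    · by_cases hvn : triNorm v ≤ 2 * M
      · have hvT : v ∈ trapD M := mem_trapD_of_triNorm_le (by omega) hvn
        -- `v` is above, hence off `lower c z`, hence unfrozen
        have hva := hvin hvn
        have hvl : v ∉ (trapDomain M).lower c z := fun h =>
          ((JDomain.mem_lower_iff_not_mem_above (show v ∈ (trapDomain M).D from hvT)).1 h) hva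
        exact (hagree v hvl).1 hvω'
      · rw [not_le] at hvn
        exact (hext v hvn).1 hvω'
  exact ⟨q, hqS', p, hpq.symm, (hpath.mono hsub).symm⟩

end Literature.Probability.Percolation
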